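import Summits.Parity.GeneralizedHardyLittlewood.Theorems.PrimeLevelFamEdgeMomentsBeyondDiagonalDiagRemTwoTwoEnvelopes
import HarnessLib

/-!
# Route `PrimeLevelFamEdge`, crux K_A `MomentsBeyondDiagonal` (stmt-Parity-20007), line «petersson_layers» v4, stub `stub_diag`:
# **the continued Bose remainders `r₀₃, r₁₃` of ORDER `(1,3)` in `Π`-form, and the EIGHT kernels of order `(1,3)` under one set
# of constants** (brick B2/B4b of the order-`(1,3)` remainder estimate (R₁₃))

The order-`(1,3)` piece of `stub_diag` is reduced to the single analytic input (R₁₃)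
(`…DiagDecorOrderOneThreeTarget.orderOneThree_target_of_remainder`, p831701). Its weight (the Hecke-summed weight
`…DiagDecorOrderRungThreeHecke.heckeSum_orderOneThree_eq`) carries the eight continued Bose kernels `r_ab`, `a ≤ 1`, `b ≤ 3`;
six of them (`r₀₀, r₀₁, r₀₂, r₁₀, r₁₁, r₁₂`) are in the tree in `Π`-form with the common envelope `9C₀(1+|log 2αY²|)⁶`
(`…DiagRemTwoTwoBoseA`, `…DiagRemTwoTwoBoseB`, `…DiagRemTwoTwoColumns`). This file adds the two NEW kernels and puts all eight
under ONE envelope constant, exactly as `…DiagRemTwoTwoEnvelopes.twoSeq_nine₂₂` does for order `(2,2)`: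

* `abs_doubleSum_rem_le₁₃b` — the general-`(a,b)` two-sequence Abel estimate `…DiagRemBoseTwoSeq.abs_doubleSum_bose_rem_le₂`
  at `(a,b) = (0,3), (1,3)`, the remainder written in `Π`-form with the moments `μ₂ = ∫₀¹log²v·v/(1+v²)²`,
  `μ₄ = ∫₀¹log⁴v·v/(1+v²)²` EXPLICIT: **`Π₀₃ = −L⁴/64 − (3/2)μ₂L² + E₀₃`, `Π₁₃ = L⁵/160 − 2μ₄L + E₁₃`** (`μ₀ = 1/4`; the odd
  moments cancel, and so do the `μ₂L³` terms of `Π₁₃`), common envelope exponent `6` (`a + b + 1 ≤ 5`);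
* `twoSeq_eight₁₃` — **`∃ E₀₀ E₀₁ E₀₂ E₀₃ E₁₀ E₁₁ E₁₂ E₁₃ C₀ C_P ≥ 0`: the eight two-sequence estimates of order `(1,3)`
  (common `C₀`, moments explicit) in the disjunctive form of `twoSeq_nine₂₂`, and the budget-sharp both-sided `P₂ ⊗ P₂ · r₀₀`
  bound of `…DiagRemTwoTwoColumns.abs_bothsided_primeSq_rem00_le₂` with the SAME `E₀₀`.**

These are the kernel inputs of the inner estimate of (R₁₃) (the analogue of `…DiagRemTwoTwoInner.abs_inner_rem_le₂₂`: same
columns `1`, `P₂`, `3P₂²−2P₄`, same homogeneous weight `4`, hence the same `Λ¹²` budget and log saving `12`).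
Def-free; theorems only. Helper `--supports stmt-Parity-20007`; closes nothing; K_A, K_B and the Parity summit are NOT proved;
nothing about Landau–Siegel zeros.

## References
* E. Kowalski, P. Michel, J. VanderKam, J. reine angew. Math. 526 (2000), (22)–(28) pp. 12–15 and Prop. 5.1 p. 18.
  [cite: KowalskiMichelVanderKam2000, Prop. 5.1 — derivation (corner of the diagonal, general Q, remainder weights, order (1,3))]
-/

noncomputable section

open scoped Real
open Finset Real MeasureTheory

namespace Summit.Parity.GeneralizedHardyLittlewood.Theorems.MomentsBeyondDiagonal.DiagCorner

open Summit.Parity.GeneralizedHardyLittlewood.Theorems.BeyondDiagonalBeatsQuarter.KernelFormXSq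
  (copTauW divWeight divWeight_nonneg)
open Summit.Parity.GeneralizedHardyLittlewood.Theorems.BeyondDiagonalBeatsQuarter.Corner
open Summit.Parity.GeneralizedHardyLittlewood.Theorems.MomentsBeyondDiagonal.DiagLines

set_option maxHeartbeats 800000 in
-- two large kernel statements
/-- **THE CONTINUED BOSE REMAINDERS `r₀₃, r₁₃` IN `Π`-FORM (moments `μ₂, μ₄` explicit), TWO-SEQUENCE ABEL ESTIMATE WITH THE
COMMON ENVELOPE `9C₀(1+|log 2αY²|)⁶`.** [cite: KowalskiMichelVanderKam2000, (22)–(28) and Prop. 5.1 — derivation (corner of the diagonal, general Q, order (1,3))] -/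
theorem abs_doubleSum_rem_le₁₃b : ∃ E₀₃ E₁₃ C₀ : ℝ, 0 ≤ C₀ ∧
    ∀ (a₁ a₂ : ℕ → ℝ) (Y α B η : ℝ) (K₁ i j : ℕ), 1 ≤ Y → 0 < α → 1 ≤ i → 1 ≤ j →
      (∀ e : ℕ, e ≤ ⌊Y⌋₊ → |∑ k ∈ Icc 1 e, a₂ k| ≤ B) → (∀ e : ℕ, K₁ ≤ e → |∑ k ∈ Icc 1 e, a₁ k| ≤ η) →
      2 * α * K₁ * Y ≤ 1 →
    |∑ k₁ ∈ Icc 1 ⌊Y⌋₊, ∑ k₂ ∈ Icc 1 ⌊Y⌋₊,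
        a₁ k₁ * a₂ k₂ * ellp Y k₁ ^ i * ellp Y k₂ ^ j *
          ((∫ u₁ in Set.Ioi (0 : ℝ), ∫ u₂ in Set.Ioi ((α * k₁ * k₂) / u₁),
              Real.exp (-(u₁ + u₂)) / (1 - Real.exp (-(u₁ + u₂))) ^ 2 * Real.log u₂ ^ 3) -
            (-(Real.log (1 / (α * k₁ * k₂)) ^ 4) / 64 - 3 * (∫ v in Set.Ioc (0 : ℝ) 1, Real.log v ^ 2 * (v / (1 + v ^ 2) ^ 2)) / 2 * Real.log (1 / (α * k₁ * k₂)) ^ 2 + E₀₃))| ≤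
      (∑ k ∈ Icc 1 ⌊Y⌋₊, |a₁ k| * ellp Y k ^ i) * (B * (Real.log Y ^ j * (3 * C₀ * Real.sqrt (2 * α * K₁ * Y)))) +
        (∑ k ∈ Icc 1 ⌊Y⌋₊, |a₂ k| * ellp Y k ^ j) *
          ((2 * η) * (Real.log Y ^ i * (9 * C₀ * (1 + |Real.log (2 * α * Y ^ 2)|) ^ 6))) ∧
    |∑ k₁ ∈ Icc 1 ⌊Y⌋₊, ∑ k₂ ∈ Icc 1 ⌊Y⌋₊,
        a₁ k₁ * a₂ k₂ * ellp Y k₁ ^ i * ellp Y k₂ ^ j *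
          ((∫ u₁ in Set.Ioi (0 : ℝ), Real.log u₁ * ∫ u₂ in Set.Ioi ((α * k₁ * k₂) / u₁),
              Real.exp (-(u₁ + u₂)) / (1 - Real.exp (-(u₁ + u₂))) ^ 2 * Real.log u₂ ^ 3) -
            (Real.log (1 / (α * k₁ * k₂)) ^ 5 / 160 - 2 * (∫ v in Set.Ioc (0 : ℝ) 1, Real.log v ^ 4 * (v / (1 + v ^ 2) ^ 2)) * Real.log (1 / (α * k₁ * k₂)) + E₁₃))| ≤
      (∑ k ∈ Icc 1 ⌊Y⌋₊, |a₁ k| * ellp Y k ^ i) * (B * (Real.log Y ^ j * (3 * C₀ * Real.sqrt (2 * α * K₁ * Y)))) +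
        (∑ k ∈ Icc 1 ⌊Y⌋₊, |a₂ k| * ellp Y k ^ j) *
          ((2 * η) * (Real.log Y ^ i * (9 * C₀ * (1 + |Real.log (2 * α * Y ^ 2)|) ^ 6))) := by
  obtain ⟨C₀₃, hC₀₃, h₀₃⟩ := abs_doubleSum_bose_rem_le₂ 0 3
  obtain ⟨C₁₃, hC₁₃, h₁₃⟩ := abs_doubleSum_bose_rem_le₂ 1 3
  set C₀ : ℝ := max C₀₃ C₁₃ with hC₀
  have e₀₃ : C₀₃ ≤ C₀ := le_max_left _ _
  have e₁₃ : C₁₃ ≤ C₀ := le_max_right _ _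
  have hC₀0 : 0 ≤ C₀ := hC₀₃.trans e₀₃
  refine ⟨(∫ u₁ in Set.Ioi (0 : ℝ), Real.log u₁ ^ 0 * ∫ u₂ in Set.Ioi (1 / u₁),
        Real.exp (-(u₁ + u₂)) / (1 - Real.exp (-(u₁ + u₂))) ^ 2 * Real.log u₂ ^ 3) +
      (∫ η in Set.Ioc (0 : ℝ) 1, (η * (∫ u in Set.Ioi (0 : ℝ), Real.log u ^ 0 * Real.log (η / u) ^ 3 *
            (Real.exp (-(u + η / u)) / (1 - Real.exp (-(u + η / u))) ^ 2) / u) -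
          ∫ v in Set.Ioc (0 : ℝ) 1, ((-(Real.log (1 / η) / 2) + Real.log v) ^ 0 * (-(Real.log (1 / η) / 2) - Real.log v) ^ 3 +
              (-(Real.log (1 / η) / 2) - Real.log v) ^ 0 * (-(Real.log (1 / η) / 2) + Real.log v) ^ 3) *
            (v / (1 + v ^ 2) ^ 2)) / η),
    (∫ u₁ in Set.Ioi (0 : ℝ), Real.log u₁ ^ 1 * ∫ u₂ in Set.Ioi (1 / u₁),
        Real.exp (-(u₁ + u₂)) / (1 - Real.exp (-(u₁ + u₂))) ^ 2 * Real.log u₂ ^ 3) +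
      (∫ η in Set.Ioc (0 : ℝ) 1, (η * (∫ u in Set.Ioi (0 : ℝ), Real.log u ^ 1 * Real.log (η / u) ^ 3 *
            (Real.exp (-(u + η / u)) / (1 - Real.exp (-(u + η / u))) ^ 2) / u) -
          ∫ v in Set.Ioc (0 : ℝ) 1, ((-(Real.log (1 / η) / 2) + Real.log v) ^ 1 * (-(Real.log (1 / η) / 2) - Real.log v) ^ 3 +
              (-(Real.log (1 / η) / 2) - Real.log v) ^ 1 * (-(Real.log (1 / η) / 2) + Real.log v) ^ 3) *
            (v / (1 + v ^ 2) ^ 2)) / η),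
    C₀, hC₀0, fun a₁ a₂ Y α B η K₁ i j hY hα hi hj hB hη hY₁ ↦ ?_⟩
  have hY0 : 0 < Y := by linarith
  have hη0 : 0 ≤ η := (abs_nonneg _).trans (hη K₁ le_rfl)
  have hLY : 0 ≤ Real.log Y := Real.log_nonneg hY
  have hx : (1 : ℝ) ≤ 1 + |Real.log (2 * α * Y ^ 2)| := by linarith [abs_nonneg (Real.log (2 * α * Y ^ 2))]
  have hSj : 0 ≤ ∑ k ∈ Icc 1 ⌊Y⌋₊, |a₂ k| * ellp Y k ^ j :=
    Finset.sum_nonneg fun k _ ↦ mul_nonneg (abs_nonneg _) (pow_nonneg (ellp_nonneg Y k) j)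
  have hSi : 0 ≤ ∑ k ∈ Icc 1 ⌊Y⌋₊, |a₁ k| * ellp Y k ^ i :=
    Finset.sum_nonneg fun k _ ↦ mul_nonneg (abs_nonneg _) (pow_nonneg (ellp_nonneg Y k) i)
  have hB0 : 0 ≤ B := (abs_nonneg _).trans (hB 0 (Nat.zero_le _))
  have hsq : 0 ≤ Real.sqrt (2 * α * K₁ * Y) := Real.sqrt_nonneg _
  have hc32 : Nat.choose 3 2 = 3 := by decide
  have hfirst : ∀ {C : ℝ}, C ≤ C₀ →
      (∑ k ∈ Icc 1 ⌊Y⌋₊, |a₁ k| * ellp Y k ^ i) * (B * (Real.log Y ^ j * (3 * C * Real.sqrt (2 * α * K₁ * Y)))) ≤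
      (∑ k ∈ Icc 1 ⌊Y⌋₊, |a₁ k| * ellp Y k ^ i) * (B * (Real.log Y ^ j * (3 * C₀ * Real.sqrt (2 * α * K₁ * Y)))) := by
    intro C hC
    have hLj : 0 ≤ Real.log Y ^ j := pow_nonneg hLY j
    gcongr
  have hsecond : ∀ {C : ℝ} {N : ℕ}, 0 ≤ C → C ≤ C₀ →
      (∑ k ∈ Icc 1 ⌊Y⌋₊, |a₂ k| * ellp Y k ^ j) * ((2 * η) * (Real.log Y ^ i *
          (3 * (C + C * (1 + |Real.log (2 * α * Y ^ 2)|) ^ N) + 2 * C +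
            C * (1 + |Real.log (2 * α * Y ^ 2)|) ^ N * (1 + |Real.log (2 * α * Y ^ 2)|)))) ≤
      (∑ k ∈ Icc 1 ⌊Y⌋₊, |a₂ k| * ellp Y k ^ j) * ((2 * η) * (Real.log Y ^ i *
          (3 * (C₀ + C₀ * (1 + |Real.log (2 * α * Y ^ 2)|) ^ N) + 2 * C₀ +
            C₀ * (1 + |Real.log (2 * α * Y ^ 2)|) ^ N * (1 + |Real.log (2 * α * Y ^ 2)|)))) := by
    intro C N hC hCC
    have hLi : 0 ≤ Real.log Y ^ i := pow_nonneg hLY i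
    have hxN : 0 ≤ (1 + |Real.log (2 * α * Y ^ 2)|) ^ N := pow_nonneg (by positivity) N
    gcongr
  refine ⟨?_, ?_⟩
  · have h := h₀₃ a₁ a₂ Y α B η K₁ i j hY hα hi hj hB hη hY₁
    have h' := le_trans h (add_le_add (hfirst e₀₃) (hsecond hC₀₃ e₀₃))
    have h'' := weaken_second_term6 hSj hη0 hLY hC₀0 hx (by norm_num : 0 + 3 + 1 ≤ 5) h'
    refine le_trans (le_of_eq ?_) h''
    congr 1
    refine Finset.sum_congr rfl fun k₁ _ ↦ Finset.sum_congr rfl fun k₂ _ ↦ ?_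
    simp only [Finset.sum_range_succ, Finset.sum_range_zero, zero_add, add_zero, Nat.choose_self,
      Nat.choose_zero_right, Nat.choose_one_right, hc32, Nat.cast_one, Nat.cast_ofNat, Nat.sub_self, Nat.sub_zero,
      Nat.reduceSub, Nat.reduceAdd, Nat.cast_zero, Nat.cast_add, pow_zero, pow_one, one_mul, mul_one,
      integral_model_weight_Ioc]
    ring
  · have h := h₁₃ a₁ a₂ Y α B η K₁ i j hY hα hi hj hB hη hY₁
    have h' := le_trans h (add_le_add (hfirst e₁₃) (hsecond hC₁₃ e₁₃))
    have h'' := weaken_second_term6 hSj hη0 hLY hC₀0 hx (by norm_num : 1 + 3 + 1 ≤ 5) h'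
    refine le_trans (le_of_eq ?_) h''
    congr 1
    refine Finset.sum_congr rfl fun k₁ _ ↦ Finset.sum_congr rfl fun k₂ _ ↦ ?_
    simp only [Finset.sum_range_succ, Finset.sum_range_zero, zero_add, add_zero, Nat.choose_self,
      Nat.choose_zero_right, Nat.choose_one_right, hc32, Nat.cast_one, Nat.cast_ofNat, Nat.sub_self, Nat.sub_zero,
      Nat.reduceSub, Nat.reduceAdd, Nat.cast_zero, Nat.cast_add, pow_zero, pow_one, one_mul, mul_one,
      integral_model_weight_Ioc]
    ring

set_option maxHeartbeats 1600000 in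
-- eight kernels, large statement
/-- **The eight remainder kernels of order `(1,3)` under one set of constants, plus the both-sided monomial** (module docstring;
the order-`(1,3)` twin of `…DiagRemTwoTwoEnvelopes.twoSeq_nine₂₂`).
[cite: KowalskiMichelVanderKam2000, (23)–(28) and Prop. 5.1 — derivation (order-(1,3) remainder, inner sums)] -/
theorem twoSeq_eight₁₃ : ∃ E₀₀ E₀₁ E₁₀ E₀₂ E₁₁ E₁₂ E₀₃ E₁₃ C₀ C_P : ℝ, 0 ≤ C₀ ∧ 0 ≤ C_P ∧
    (∀ R : ℝ → ℝ,
      (R = (fun y : ℝ ↦ ((∫ u₁ in Set.Ioi (0 : ℝ), ∫ u₂ in Set.Ioi (y / u₁),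
              Real.exp (-(u₁ + u₂)) / (1 - Real.exp (-(u₁ + u₂))) ^ 2) -
            (Real.log (1 / y) / 2 + E₀₀))) ∨
       R = (fun y : ℝ ↦ ((∫ u₁ in Set.Ioi (0 : ℝ), ∫ u₂ in Set.Ioi (y / u₁),
              Real.exp (-(u₁ + u₂)) / (1 - Real.exp (-(u₁ + u₂))) ^ 2 * Real.log u₂) -
            (-(Real.log (1 / y) ^ 2) / 8 + E₀₁))) ∨
       R = (fun y : ℝ ↦ ((∫ u₁ in Set.Ioi (0 : ℝ), Real.log u₁ * ∫ u₂ in Set.Ioi (y / u₁),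
              Real.exp (-(u₁ + u₂)) / (1 - Real.exp (-(u₁ + u₂))) ^ 2) -
            (-(Real.log (1 / y) ^ 2) / 8 + E₁₀))) ∨
       R = (fun y : ℝ ↦ ((∫ u₁ in Set.Ioi (0 : ℝ), ∫ u₂ in Set.Ioi (y / u₁),
              Real.exp (-(u₁ + u₂)) / (1 - Real.exp (-(u₁ + u₂))) ^ 2 * Real.log u₂ ^ 2) -
            (Real.log (1 / y) ^ 3 / 24 + 2 * (∫ v in Set.Ioc (0 : ℝ) 1, Real.log v ^ 2 * (v / (1 + v ^ 2) ^ 2)) * Real.log (1 / y) + E₀₂))) ∨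
       R = (fun y : ℝ ↦ ((∫ u₁ in Set.Ioi (0 : ℝ), Real.log u₁ * ∫ u₂ in Set.Ioi (y / u₁),
              Real.exp (-(u₁ + u₂)) / (1 - Real.exp (-(u₁ + u₂))) ^ 2 * Real.log u₂) -
            (Real.log (1 / y) ^ 3 / 24 - 2 * (∫ v in Set.Ioc (0 : ℝ) 1, Real.log v ^ 2 * (v / (1 + v ^ 2) ^ 2)) * Real.log (1 / y) + E₁₁))) ∨
       R = (fun y : ℝ ↦ ((∫ u₁ in Set.Ioi (0 : ℝ), Real.log u₁ * ∫ u₂ in Set.Ioi (y / u₁),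
              Real.exp (-(u₁ + u₂)) / (1 - Real.exp (-(u₁ + u₂))) ^ 2 * Real.log u₂ ^ 2) -
            (-(Real.log (1 / y) ^ 4) / 64 + (∫ v in Set.Ioc (0 : ℝ) 1, Real.log v ^ 2 * (v / (1 + v ^ 2) ^ 2)) * Real.log (1 / y) ^ 2 / 2 + E₁₂))) ∨
       R = (fun y : ℝ ↦ ((∫ u₁ in Set.Ioi (0 : ℝ), ∫ u₂ in Set.Ioi (y / u₁),
              Real.exp (-(u₁ + u₂)) / (1 - Real.exp (-(u₁ + u₂))) ^ 2 * Real.log u₂ ^ 3) -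
            (-(Real.log (1 / y) ^ 4) / 64 - 3 * (∫ v in Set.Ioc (0 : ℝ) 1, Real.log v ^ 2 * (v / (1 + v ^ 2) ^ 2)) / 2 * Real.log (1 / y) ^ 2 + E₀₃))) ∨
       R = (fun y : ℝ ↦ ((∫ u₁ in Set.Ioi (0 : ℝ), Real.log u₁ * ∫ u₂ in Set.Ioi (y / u₁),
              Real.exp (-(u₁ + u₂)) / (1 - Real.exp (-(u₁ + u₂))) ^ 2 * Real.log u₂ ^ 3) -
            (Real.log (1 / y) ^ 5 / 160 - 2 * (∫ v in Set.Ioc (0 : ℝ) 1, Real.log v ^ 4 * (v / (1 + v ^ 2) ^ 2)) * Real.log (1 / y) + E₁₃)))) →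
      ∀ (a₁ a₂ : ℕ → ℝ) (Y α B η : ℝ) (K₁ i j : ℕ), 1 ≤ Y → 0 < α → 1 ≤ i → 1 ≤ j →
        (∀ e : ℕ, e ≤ ⌊Y⌋₊ → |∑ k ∈ Icc 1 e, a₂ k| ≤ B) → (∀ e : ℕ, K₁ ≤ e → |∑ k ∈ Icc 1 e, a₁ k| ≤ η) →
        2 * α * K₁ * Y ≤ 1 →
      |∑ k₁ ∈ Icc 1 ⌊Y⌋₊, ∑ k₂ ∈ Icc 1 ⌊Y⌋₊,
          a₁ k₁ * a₂ k₂ * ellp Y k₁ ^ i * ellp Y k₂ ^ j * R (α * k₁ * k₂)| ≤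
        (∑ k ∈ Icc 1 ⌊Y⌋₊, |a₁ k| * ellp Y k ^ i) * (B * (Real.log Y ^ j * (3 * C₀ * Real.sqrt (2 * α * K₁ * Y)))) +
          (∑ k ∈ Icc 1 ⌊Y⌋₊, |a₂ k| * ellp Y k ^ j) *
            ((2 * η) * (Real.log Y ^ i * (9 * C₀ * (1 + |Real.log (2 * α * Y ^ 2)|) ^ 6)))) ∧
    (∀ n : ℕ, n ≠ 0 → ∀ (Y α : ℝ) (K₁ i j : ℕ), 1 ≤ Y → 0 < α → 1 ≤ i → 1 ≤ j → 2 * α * K₁ * Y ≤ 1 →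
    |∑ k₁ ∈ Icc 1 ⌊Y⌋₊, ∑ k₂ ∈ Icc 1 ⌊Y⌋₊,
        (copTauW n k₁ * ∑ p ∈ k₁.primeFactors, Real.log p ^ 2) * (copTauW n k₂ * ∑ p ∈ k₂.primeFactors, Real.log p ^ 2) *
          ellp Y k₁ ^ i * ellp Y k₂ ^ j * (fun y : ℝ ↦ ((∫ u₁ in Set.Ioi (0 : ℝ), ∫ u₂ in Set.Ioi (y / u₁),
              Real.exp (-(u₁ + u₂)) / (1 - Real.exp (-(u₁ + u₂))) ^ 2) -
            (Real.log (1 / y) / 2 + E₀₀))) (α * k₁ * k₂)| ≤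
      Real.log Y ^ (i + j) * (C₀ *
        ((3 * ((1 + Real.log Y) ^ 4 + C_P * divWeight n) * (1 + Real.log Y) ^ 4 +
            3 * (C_P * divWeight n) * ((1 + Real.log Y) ^ 4 + C_P * divWeight n) + (C_P * divWeight n) ^ 2) *
            Real.sqrt (2 * α * K₁ * Y) +
          (18 * (1 + Real.log Y) ^ 4 * (C_P * divWeight n) + 19 * (C_P * divWeight n) ^ 2) *
            (1 + |Real.log (2 * α * Y ^ 2)|) ^ 6 / (1 + Real.log K₁) ^ 12))) := by
  obtain ⟨E₀₀, C₀z, C_P, hC₀z, hC_P, hR00, hBS⟩ := abs_bothsided_primeSq_rem00_le₂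
  obtain ⟨E₀₀', E₀₁, E₀₂, E₁₀, E₁₁, C₀a, hC₀a, hA⟩ := abs_doubleSum_rem_le₂₂a
  obtain ⟨E₁₂, E₂₀, E₂₁, E₂₂, C₀b, hC₀b, hBb⟩ := abs_doubleSum_rem_le₂₂b
  obtain ⟨E₀₃, E₁₃, C₀c, hC₀c, hCc⟩ := abs_doubleSum_rem_le₁₃b
  set C₀ : ℝ := max (max C₀z C₀a) (max C₀b C₀c) with hC₀def
  have ez : C₀z ≤ C₀ := (le_max_left _ _).trans (le_max_left _ _)
  have ea : C₀a ≤ C₀ := (le_max_right _ _).trans (le_max_left _ _)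
  have eb : C₀b ≤ C₀ := (le_max_left _ _).trans (le_max_right _ _)
  have ec : C₀c ≤ C₀ := (le_max_right _ _).trans (le_max_right _ _)
  have hC₀ : 0 ≤ C₀ := hC₀z.trans ez
  refine ⟨E₀₀, E₀₁, E₁₀, E₀₂, E₁₁, E₁₂, E₀₃, E₁₃, C₀, C_P, hC₀, hC_P, ?_, ?_⟩
  · intro R hRR a₁ a₂ Y α B η K₁ i j hY hα hi hj hcol hrow hY₁
    have hLY0 : 0 ≤ Real.log Y := Real.log_nonneg hY
    have hB0 : 0 ≤ B := (abs_nonneg _).trans (hcol 0 (Nat.zero_le _))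
    have hη0 : 0 ≤ η := (abs_nonneg _).trans (hrow K₁ le_rfl)
    have hS₁ : 0 ≤ ∑ k ∈ Icc 1 ⌊Y⌋₊, |a₁ k| * ellp Y k ^ i :=
      Finset.sum_nonneg fun k _ ↦ mul_nonneg (abs_nonneg _) (pow_nonneg (ellp_nonneg Y k) i)
    have hS₂ : 0 ≤ ∑ k ∈ Icc 1 ⌊Y⌋₊, |a₂ k| * ellp Y k ^ j :=
      Finset.sum_nonneg fun k _ ↦ mul_nonneg (abs_nonneg _) (pow_nonneg (ellp_nonneg Y k) j)
    have hLi : 0 ≤ Real.log Y ^ i := pow_nonneg hLY0 i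
    have hLj : 0 ≤ Real.log Y ^ j := pow_nonneg hLY0 j
    have hs0 : 0 ≤ Real.sqrt (2 * α * K₁ * Y) := Real.sqrt_nonneg _
    have hx0 : 0 ≤ 1 + |Real.log (2 * α * Y ^ 2)| := by positivity
    rcases hRR with rfl | rfl | rfl | rfl | rfl | rfl | rfl | rfl
    · exact twoSeq_envelope_mono hS₁ hS₂ hB0 hη0 hLi hLj hs0 hx0 ez
        (hR00 a₁ a₂ Y α B η K₁ i j hY hα hi hj hcol hrow hY₁)
    · exact twoSeq_envelope_mono hS₁ hS₂ hB0 hη0 hLi hLj hs0 hx0 ea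
        (hA a₁ a₂ Y α B η K₁ i j hY hα hi hj hcol hrow hY₁).2.1
    · exact twoSeq_envelope_mono hS₁ hS₂ hB0 hη0 hLi hLj hs0 hx0 ea
        (hA a₁ a₂ Y α B η K₁ i j hY hα hi hj hcol hrow hY₁).2.2.2.1
    · exact twoSeq_envelope_mono hS₁ hS₂ hB0 hη0 hLi hLj hs0 hx0 ea
        (hA a₁ a₂ Y α B η K₁ i j hY hα hi hj hcol hrow hY₁).2.2.1
    · exact twoSeq_envelope_mono hS₁ hS₂ hB0 hη0 hLi hLj hs0 hx0 ea
        (hA a₁ a₂ Y α B η K₁ i j hY hα hi hj hcol hrow hY₁).2.2.2.2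
    · exact twoSeq_envelope_mono hS₁ hS₂ hB0 hη0 hLi hLj hs0 hx0 eb
        (hBb a₁ a₂ Y α B η K₁ i j hY hα hi hj hcol hrow hY₁).1
    · exact twoSeq_envelope_mono hS₁ hS₂ hB0 hη0 hLi hLj hs0 hx0 ec
        (hCc a₁ a₂ Y α B η K₁ i j hY hα hi hj hcol hrow hY₁).1
    · exact twoSeq_envelope_mono hS₁ hS₂ hB0 hη0 hLi hLj hs0 hx0 ec
        (hCc a₁ a₂ Y α B η K₁ i j hY hα hi hj hcol hrow hY₁).2
  · intro n hn Y α K₁ i j hY hα hi hj hY₁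
    refine (hBS n hn Y α K₁ i j hY hα hi hj hY₁).trans ?_
    have hLY0 : 0 ≤ Real.log Y := Real.log_nonneg hY
    have hD := divWeight_nonneg n
    have hbr : 0 ≤ (3 * ((1 + Real.log Y) ^ 4 + C_P * divWeight n) * (1 + Real.log Y) ^ 4 +
            3 * (C_P * divWeight n) * ((1 + Real.log Y) ^ 4 + C_P * divWeight n) + (C_P * divWeight n) ^ 2) *
            Real.sqrt (2 * α * K₁ * Y) +
          (18 * (1 + Real.log Y) ^ 4 * (C_P * divWeight n) + 19 * (C_P * divWeight n) ^ 2) *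
            (1 + |Real.log (2 * α * Y ^ 2)|) ^ 6 / (1 + Real.log K₁) ^ 12 := by
      have : 0 ≤ Real.log (K₁ : ℝ) := Real.log_natCast_nonneg K₁
      positivity
    exact mul_le_mul_of_nonneg_left (mul_le_mul_of_nonneg_right ez hbr) (pow_nonneg hLY0 _)

end Summit.Parity.GeneralizedHardyLittlewood.Theorems.MomentsBeyondDiagonal.DiagCorner

end
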